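import Literature.NumberTheory.Automorphic.RankinSelbergUnfoldedEulerCuspidal
import Literature.NumberTheory.Automorphic.SmoothedFormCentralCharacter
import Literature.NumberTheory.Automorphic.UnitIdeleArchPushforward
import Literature.NumberTheory.Automorphic.IdeleUnitBoxShells
import Literature.NumberTheory.Automorphic.KirillovL2BoundFinite
import HarnessLib

/-!
# Pointwise reductions of the `GL_2` torus integrand at `s = 1`

Topic `NumberTheory/Automorphic`; namespace `Literature.NumberTheory.Automorphic`. Theorems only; part of
the plumbing of the Kirillov `L²`-bound (`KirillovL2BoundFinite.exists_kirillovL2Bound`) into the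
bad-place Rankin–Selberg torus integral at `s = 1` (hypothesis `hfin` of
`PairLFunctionPolesEqConjFirstMoment.JacquetShalika1981_partialPairL_pole_of_eq_conj_of_firstMoment`),
the `n ≤ 2` case of the named fact `JacquetShalika1981_partialPairL_pole_of_eq_conj`
(Jacquet–Shalika (1981), §4–§5):

* `glDiagonal_two_eq_scalar_mul` — `diag(a₀, a₁) = (a₁ 1₂) · diag(a₀ a₁⁻¹, 1)`;
* `norm_whittakerCoeff_glDiagonal_two_eq` — for the Whittaker coefficient of a smoothed cusp form of a
  cuspidal `Π` (which has a unitary central character, `SmoothedFormCentralCharacter`):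
  `‖W(diag(a₀, a₁) k)‖ = ‖W(diag(a₀ a₁⁻¹, 1) k)‖`;
* `archDilationAdelic_eq_glDiagonal` — `(a(x), 1) = diag((x, 1), 1)`;
* `finUnitPart`, `glDiagonal_finUnitPart_mem_glIntegralLevel` — `b = (b_∞, 1) b_f` with
  `diag(b_f, 1) ∈ GL_2(𝒪̂)` for `b ∈ 𝕌_K`;
* `torusShellProd_eq_glDiagonal_shellIdele`, `glDiagonal_shellIdele_mul` — the torus shell product of
  `KirillovL2BoundFinite` is `diag(ϖ^m, 1)` (`IdeleUnitBoxShells.shellIdele`), and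
  `diag(ϖ^m b, 1) = (∏_v ι_v diag(ϖ_v^{m_v}, 1)) (a(b_∞), 1) diag(b_f, 1)`.

## References

* H. Jacquet, J. A. Shalika, Amer. J. Math. 103 (1981), §4–§5 [JacquetShalikaAJM1981].
* A. Borel, H. Jacquet, Proc. Sympos. Pure Math. 33.1 (1979), §4.6, §5.7 [BorelJacquetCorvallis1979].
-/

noncomputable section

open MeasureTheory Measure NumberField NumberField.mixedEmbedding IsDedekindDomain Matrix Set
open scoped MatrixGroups ENNReal NNReal ComplexConjugate
open Literature.NumberTheory.GaloisRepresentations (ideleGroup)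

namespace Literature.NumberTheory.Automorphic

-- the automorphic quotient carries the tree's Borel σ-algebra, not Mathlib's quotient σ-algebra
attribute [-instance] Quotient.instMeasurableSpace QuotientGroup.measurableSpace

section Center

variable {K : Type} [Field K] [NumberField K]

/-- The sheared torus coordinate `(a₀ a₁⁻¹, 1)`. [folklore] -/
def shearTorus (a : Fin 2 → ideleGroup K) : Fin 2 → ideleGroup K := ![a 0 * (a 1)⁻¹, 1]

/-- The first sheared coordinate. [folklore] -/
@[simp] theorem shearTorus_zero (a : Fin 2 → ideleGroup K) : shearTorus a 0 = a 0 * (a 1)⁻¹ := rfl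
/-- The second sheared coordinate. [folklore] -/
@[simp] theorem shearTorus_one (a : Fin 2 → ideleGroup K) : shearTorus a 1 = 1 := rfl

/-- **`diag(a₀, a₁) = (a₁ 1₂) · diag(a₀ a₁⁻¹, 1)`.** [folklore] -/
theorem glDiagonal_two_eq_scalar_mul (a : Fin 2 → ideleGroup K) :
    glDiagonal 2 (AdeleRing (𝓞 K) K) a =
      Matrix.GeneralLinearGroup.scalar (Fin 2) (a 1) * glDiagonal 2 (AdeleRing (𝓞 K) K) (shearTorus a) := by
  refine Matrix.GeneralLinearGroup.ext fun i j => ?_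
  rw [Matrix.GeneralLinearGroup.coe_mul, Matrix.GeneralLinearGroup.coe_scalar, coe_glDiagonal, coe_glDiagonal,
    Matrix.scalar_apply, Matrix.diagonal_mul_diagonal]
  by_cases hij : i = j
  · subst hij
    rw [Matrix.diagonal_apply_eq, Matrix.diagonal_apply_eq]
    fin_cases i
    · show ((a 0 : ideleGroup K) : AdeleRing (𝓞 K) K) = (a 1 : AdeleRing (𝓞 K) K) * ((a 0 * (a 1)⁻¹ : ideleGroup K) : AdeleRing (𝓞 K) K)
      rw [Units.val_mul, mul_left_comm, Units.mul_inv, mul_one]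
    · show ((a 1 : ideleGroup K) : AdeleRing (𝓞 K) K) = (a 1 : AdeleRing (𝓞 K) K) * ((1 : ideleGroup K) : AdeleRing (𝓞 K) K)
      rw [Units.val_one, mul_one]
  · rw [Matrix.diagonal_apply_ne _ hij, Matrix.diagonal_apply_ne _ hij]

variable {μ : Measure (AdelicGroupData.gl 2 K).automorphicQuotient} [(AdelicGroupData.gl 2 K).IsAutomorphicMeasure μ]
variable [MeasurableSpace ↥(adelicUnipotent 2 K)]

/-- **`‖W(diag(a₀, a₁) k)‖ = ‖W(diag(a₀ a₁⁻¹, 1) k)‖`** for the Whittaker coefficient of a smoothed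
form of a cuspidal `Π` of `GL_2` (unitary central character). [cite: BorelJacquetCorvallis1979, §5.7] -/
theorem norm_whittakerCoeff_glDiagonal_two_eq (P : CuspidalAutomorphicRepGL 2 K μ)
    (ν : Measure ↥(adelicUnipotent 2 K)) (𝓕 : Set ↥(adelicUnipotent 2 K)) (ψ : AddChar (AdeleRing (𝓞 K) K) Circle)
    (η : (AdelicGroupData.gl 2 K).Adelic → ℝ) (f : P.1.toSubmodule) (a : Fin 2 → ideleGroup K) (k : GL (Fin 2) (AdeleRing (𝓞 K) K)) :
    ‖whittakerCoeff ν 𝓕 ψ (invQuot (AdelicGroupData.gl 2 K) (smoothedForm η (f : (AdelicGroupData.gl 2 K).L2 μ)))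
        (glDiagonal 2 (AdeleRing (𝓞 K) K) a * k)‖ =
      ‖whittakerCoeff ν 𝓕 ψ (invQuot (AdelicGroupData.gl 2 K) (smoothedForm η (f : (AdelicGroupData.gl 2 K).L2 μ)))
        (glDiagonal 2 (AdeleRing (𝓞 K) K) (shearTorus a) * k)‖ := by
  obtain ⟨ω, hωu, -, -, -, -, hω⟩ := P.exists_centralCharacter_smoothedForm
  rw [glDiagonal_two_eq_scalar_mul, mul_assoc, whittakerCoeff_scalar_mul (fun g => hω η f (a 1) g), norm_mul,
    hωu (a 1), one_mul]

end Center

/-! ### Absorbing the unit parts into the maximal compact subgroup -/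

section Absorb

variable {K : Type} [Field K] [NumberField K]

open Literature.NumberTheory.GaloisRepresentations (unitIdeles infiniteIdeles localUnits)

/-- `(a(x), 1) = diag((x, 1), 1)`: the archimedean dilation is the diagonal idele matrix of the infinite
idele `(x, 1)`. [folklore] -/
theorem archDilationAdelic_eq_glDiagonal (x : (mixedSpace K)ˣ) :
    archDilationAdelic K x = glDiagonal 2 (AdeleRing (𝓞 K) K) ![infiniteIdeleOfMixed x, 1] := by
  show GLn.ofInfinite 2 K (diagGL2 x 1) = glDiagonal 2 (AdeleRing (𝓞 K) K) ![infiniteIdeleOfMixed x, 1]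
  refine Matrix.GeneralLinearGroup.ext fun i j => ?_
  rw [GLn.coe_ofInfinite_apply, coe_diagGL2, coe_glDiagonal]
  fin_cases i <;> fin_cases j
  · rfl
  · show ((InfiniteAdeleRing.ringEquiv_mixedSpace K).symm 0, (0 : FiniteAdeleRing (𝓞 K) K)) = (0 : AdeleRing (𝓞 K) K)
    rw [map_zero]; rfl
  · show ((InfiniteAdeleRing.ringEquiv_mixedSpace K).symm 0, (0 : FiniteAdeleRing (𝓞 K) K)) = (0 : AdeleRing (𝓞 K) K)
    rw [map_zero]; rfl
  · show ((InfiniteAdeleRing.ringEquiv_mixedSpace K).symm ((1 : (mixedSpace K)ˣ) : mixedSpace K), (1 : FiniteAdeleRing (𝓞 K) K)) =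
      (((1 : ideleGroup K)) : AdeleRing (𝓞 K) K)
    rw [Units.val_one, map_one]; rfl

/-- The finite unit part `b_f = (b_∞, 1)⁻¹ b` of a unit idele. [folklore] -/
def finUnitPart (b : ideleGroup K) : ideleGroup K := (infiniteIdeleOfMixed (archUnitsOfIdele K b))⁻¹ * b

/-- `b = (b_∞, 1) · b_f`. [folklore] -/
theorem infiniteIdeleOfMixed_mul_finUnitPart (b : ideleGroup K) : infiniteIdeleOfMixed (archUnitsOfIdele K b) * finUnitPart b = b :=
  mul_inv_cancel_left _ _

/-- `(b_∞, 1)` is the infinite idele of `b`. [folklore] -/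
theorem infiniteIdeleOfMixed_archUnitsOfIdele (b : ideleGroup K) : infiniteIdeleOfMixed (archUnitsOfIdele K b) = infiniteIdeles K (GaloisRepresentations.HeckeCharacter.infPart K b) := by
  unfold infiniteIdeleOfMixed archUnitsOfIdele
  congr 1
  refine Units.ext ?_
  show (InfiniteAdeleRing.ringEquiv_mixedSpace K).symm ((InfiniteAdeleRing.ringEquiv_mixedSpace K) _) = _
  rw [RingEquiv.symm_apply_apply]

/-- The infinite part of `b_f` is `1` and its finite components are those of `b`. [folklore] -/
theorem finUnitPart_fst_snd (b : ideleGroup K) :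
    ((finUnitPart b : ideleGroup K) : AdeleRing (𝓞 K) K).1 = 1 ∧ ∀ v, ((finUnitPart b : ideleGroup K) : AdeleRing (𝓞 K) K).2 v = ((b : ideleGroup K) : AdeleRing (𝓞 K) K).2 v := by
  unfold finUnitPart
  rw [infiniteIdeleOfMixed_archUnitsOfIdele]
  exact GaloisRepresentations.HeckeCharacter.infiniteIdeles_infPart_inv_mul b

/-- **`diag(b_f, 1) ∈ GL_2(𝒪̂)`** (the integral level) for `b ∈ 𝕌_K`. [folklore] -/
theorem glDiagonal_finUnitPart_mem_glIntegralLevel {b : ideleGroup K} (hb : b ∈ unitIdeles K) :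
    glDiagonal 2 (AdeleRing (𝓞 K) K) ![finUnitPart b, 1] ∈ glIntegralLevel 2 K := by
  obtain ⟨h1, h2⟩ := finUnitPart_fst_snd b
  have hu : finUnitPart b ∈ unitIdeles K := by
    rw [GaloisRepresentations.mem_unitIdeles_iff]; intro v; rw [h2 v]; exact GaloisRepresentations.mem_unitIdeles_iff.1 hb v
  have hu' := GaloisRepresentations.mem_unitIdeles_iff_mem_and_inv_mem.1 hu
  rw [mem_glIntegralLevel_iff']
  refine ⟨⟨fun i j => ?_, fun i j => ?_⟩, fun i j => ?_⟩
  · rw [coe_glDiagonal]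
    by_cases hij : i = j
    · subst hij; rw [Matrix.diagonal_apply_eq]
      fin_cases i
      · exact fun v => hu'.1 v
      · intro v; show (((1 : ideleGroup K) : AdeleRing (𝓞 K) K).2 v) ∈ _; exact (v.adicCompletionIntegers K).one_mem
    · rw [Matrix.diagonal_apply_ne _ hij]; intro v; exact (v.adicCompletionIntegers K).zero_mem
  · rw [← map_inv, coe_glDiagonal]
    by_cases hij : i = j
    · subst hij; rw [Matrix.diagonal_apply_eq]
      fin_cases i
      · exact fun v => hu'.2 v
      · intro v; show (((1 : ideleGroup K)⁻¹ : ideleGroup K) : AdeleRing (𝓞 K) K).2 v ∈ _; rw [inv_one]; exact (v.adicCompletionIntegers K).one_mem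
    · rw [Matrix.diagonal_apply_ne _ hij]; intro v; exact (v.adicCompletionIntegers K).zero_mem
  · rw [coe_glDiagonal]
    by_cases hij : i = j
    · subst hij; rw [Matrix.diagonal_apply_eq, Matrix.one_apply_eq]
      fin_cases i
      · exact h1
      · rfl
    · rw [Matrix.diagonal_apply_ne _ hij, Matrix.one_apply_ne hij]; rfl

end Absorb

/-! ### Torus shells as diagonal idele matrices -/

section ShellMatrices

variable {K : Type} [Field K] [NumberField K]

open Literature.NumberTheory.GaloisRepresentations (unitIdeles localUnits)

/-- `diagOneHom 𝔸 t = diag(t, 1)` (`GL2NewvectorGaussSumOperator.diagOneHom`). [folklore] -/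
theorem diagOneHom_adele_apply (t : ideleGroup K) : diagOneHom (AdeleRing (𝓞 K) K) t = glDiagonal 2 (AdeleRing (𝓞 K) K) ![t, 1] := rfl

/-- `diag(x y, 1) = diag(x, 1) diag(y, 1)`. [folklore] -/
theorem glDiagonal_vec2_mul (x y : ideleGroup K) :
    glDiagonal 2 (AdeleRing (𝓞 K) K) ![x * y, 1] = glDiagonal 2 (AdeleRing (𝓞 K) K) ![x, 1] * glDiagonal 2 (AdeleRing (𝓞 K) K) ![y, 1] :=
  (diagOneHom (AdeleRing (𝓞 K) K)).map_mul x y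

/-- `ι_v(diag(t, 1)) = diag(ι_v(t), 1)`. [folklore] -/
theorem torusAt_eq_glDiagonal (v : HeightOneSpectrum (𝓞 K)) (t : (v.adicCompletion K)ˣ) :
    torusAt (K := K) v t = glDiagonal 2 (AdeleRing (𝓞 K) K) ![localUnits v t, 1] := by
  have h : torusAt (K := K) v t = GLn.ofLocal 2 K v (diagonalGL (Fin 2) (v.adicCompletion K) ![t, 1]) := rfl
  rw [h, GLn.ofLocal_diagonalGL]
  congr 1; funext i; fin_cases i
  · rfl
  · exact map_one (localUnits (K := K) v)

/-- **The torus shell product is the diagonal matrix of the shell idele**: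
`∏_{v ∈ S'} ι_v(diag(ϖ_v^{m_v}, 1)) = diag(ϖ^m, 1)`. [folklore] -/
theorem torusShellProd_eq_glDiagonal_shellIdele (ϖ : ∀ v : HeightOneSpectrum (𝓞 K), (v.adicCompletion K)ˣ)
    (S' : Finset (HeightOneSpectrum (𝓞 K))) (m : ↥S' → ℤ) :
    torusShellProd ϖ S' m = glDiagonal 2 (AdeleRing (𝓞 K) K) ![shellIdele ϖ S' m, 1] := by
  have h1 : torusShellProd ϖ S' m = S'.noncommProd (fun v => diagOneHom (AdeleRing (𝓞 K) K) (localUnits v (ϖ v ^ extendShell m v)))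
      (fun v _ w _ hvw => by show Commute (diagOneHom (AdeleRing (𝓞 K) K) (localUnits v (ϖ v ^ extendShell m v))) (diagOneHom (AdeleRing (𝓞 K) K) (localUnits w (ϖ w ^ extendShell m w))); rw [diagOneHom_adele_apply, diagOneHom_adele_apply, ← torusAt_eq_glDiagonal, ← torusAt_eq_glDiagonal]; exact commute_torusAt hvw _ _) := by
    unfold torusShellProd
    congr 1; funext v; rw [diagOneHom_adele_apply, torusAt_eq_glDiagonal]
  have h2 : S'.noncommProd (fun v => diagOneHom (AdeleRing (𝓞 K) K) (localUnits v (ϖ v ^ extendShell m v)))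
      (fun v _ w _ hvw => by show Commute (diagOneHom (AdeleRing (𝓞 K) K) (localUnits v (ϖ v ^ extendShell m v))) (diagOneHom (AdeleRing (𝓞 K) K) (localUnits w (ϖ w ^ extendShell m w))); rw [diagOneHom_adele_apply, diagOneHom_adele_apply, ← torusAt_eq_glDiagonal, ← torusAt_eq_glDiagonal]; exact commute_torusAt hvw _ _) =
      diagOneHom (AdeleRing (𝓞 K) K) (S'.noncommProd (fun v => localUnits v (ϖ v ^ extendShell m v)) fun _ _ _ _ _ => Commute.all _ _) := by
    rw [Finset.map_noncommProd]
  rw [h1, h2, Finset.noncommProd_eq_prod, diagOneHom_adele_apply]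
  congr 2
  rw [shellIdele, ← Finset.prod_attach S']
  refine Finset.prod_congr rfl fun v _ => ?_
  rw [extendShell, dif_pos v.2]

/-- **Absorption**: for `b ∈ 𝕌_K`,
`diag(ϖ^m b, 1) = (∏_v ι_v diag(ϖ_v^{m_v}, 1)) · (a(b_∞), 1) · diag(b_f, 1)` with `diag(b_f, 1) ∈ GL_2(𝒪̂)`. [folklore] -/
theorem glDiagonal_shellIdele_mul (ϖ : ∀ v : HeightOneSpectrum (𝓞 K), (v.adicCompletion K)ˣ)
    (S' : Finset (HeightOneSpectrum (𝓞 K))) (m : ↥S' → ℤ) (b : ideleGroup K) :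
    glDiagonal 2 (AdeleRing (𝓞 K) K) ![shellIdele ϖ S' m * b, 1] =
      torusShellProd ϖ S' m * ((show GL (Fin 2) (AdeleRing (𝓞 K) K) from archDilationAdelic K (archUnitsOfIdele K b)) *
        glDiagonal 2 (AdeleRing (𝓞 K) K) ![finUnitPart b, 1]) := by
  rw [glDiagonal_vec2_mul, torusShellProd_eq_glDiagonal_shellIdele]
  congr 1
  have h : (show GL (Fin 2) (AdeleRing (𝓞 K) K) from archDilationAdelic K (archUnitsOfIdele K b)) =
      glDiagonal 2 (AdeleRing (𝓞 K) K) ![infiniteIdeleOfMixed (archUnitsOfIdele K b), 1] := archDilationAdelic_eq_glDiagonal _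
  rw [h, ← glDiagonal_vec2_mul, infiniteIdeleOfMixed_mul_finUnitPart]

end ShellMatrices

end Literature.NumberTheory.Automorphic
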